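import Literature.Analysis.FunctionSpaces.PolchinskiExchangeSmoothedJets
import Literature.Analysis.FunctionSpaces.PolchinskiExchangeSmoothedSlope
import HarnessLib

/-!
# The exchange inequality `d/dt E_{ν_t}[(∇√P_{0,t}F)²_{Ċ_t}] ≤ −2λ̇_t E_{ν_t}[(∇√P_{0,t}F)²_{Ċ_t}]`
# for initial Boltzmann weights `e^{−V₀} = Ψ` of the smoothed class (Bauerschmidt–Bodineau–Dagallier,
# proof of Theorem 3: Lemma 1 + (e:assCt-mon), when `V₀` is unbounded above)

Topic `Literature/Analysis/FunctionSpaces`; "proof architecture" file behind the named fact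
`Polchinski.BauerschmidtBodineau_multiscaleBakryEmery` ([BBD] Theorem 3, `MultiscaleBakryEmery.lean`).

`PolchinskiExchangeIneq.lean` proves the differential inequality `k′ ≤ −2λ̇k` for
`k(s) = E_{ν_s}[(∇√P_{0,s}F)²_{Ċ_s}]` when `V₀ ∈ C_b⁴` (then `P_{0,t}F = W_t/Z_t` has three bounded
derivatives).  Here the same inequality is proved for `e^{−V₀} = Ψ` in the smoothed class (`Ψ ∈ C⁸`
positive and bounded, `Ψ`-dominated derivatives, Gaussian lower bound — the class of `e^{−V_s}`, `s > 0`,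
for `V₀` merely measurable and bounded below), where `P_{0,t}F` and its derivatives are unbounded: the
`e^{−V_t}`-weighted family `K_s = Z_s·(∇√P_{0,s}F)²_{Ċ_s}` is `C_b²` (jet × tame packs,
`sqrtGradient_texchange`), its slope at `s = t` is tempered (controlled by `ε|s−t|e^{a‖y‖²}` for every
`a > 0`, uniformly in `y`, using a Gaussian lower bound for `Z_s` uniform in `s` near `t`), the tempered
family rule `hasDerivAt_integral_family_Cinf_sub_of_sqExp` differentiates `E_{ν_s}[·] = e^{V_∞(0)}E_{C_∞−C_s}[K_s]`,
and the integrand is `−e^{−V_t}·[(L_t − ∂_t)(∇√P_{0,t}F)²_{Ċ_t}] ≤ −2λ̇_t e^{−V_t}(∇√P_{0,t}F)²_{Ċ_t}` by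
[BBD] Lemma 1 and (e:assCt-mon) (`sqrtGradient_texchange`, `multiscale_jet`), p0016 L130–153.

## Main result (sorry-free; no new definitions, no new named facts)

* **`hasDerivAt_renormExpect_sqrtEnergy_le_smoothed`** — for `t > 0`:
  `k(s) = E_{ν_s}[(∇√P_{0,s}F)²_{Ċ_s}]` is differentiable at `t` with `k′(t) ≤ −2λ̇_t k(t)`, for the
  smoothed class.

Nothing here concerns Yang–Mills (no gauge instance of (e:assCt-mon) is in print; R4 = `BalabanLadder.UV`
only).

## References

* [BauerschmidtBodineauDagallier2023] R. Bauerschmidt, T. Bodineau, B. Dagallier, Probab. Surveys 21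
  (2024) 200–290, arXiv:2307.07619 — Theorem 3 proof p0016 L47–153, Lemma 1 p0016–p0017, Prop 5 p0014.
  READ (held text `paper:arxiv-2307.07619`).
* [DapratoZabczyk1992] G. Da Prato, J. Zabczyk, Stochastic Equations in Infinite Dimensions — Thm 2.7
  (Fernique; Gaussian exponential moments).
-/

noncomputable section

-- nested operator-norm instances `E →L[ℝ] E →L[ℝ] E →L[ℝ] ℝ`
set_option maxSynthPendingDepth 4

open MeasureTheory ProbabilityTheory Filter Topology Set
open scoped RealInnerProductSpace Matrix MatrixOrder

namespace Literature.Analysis.FunctionSpaces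

namespace Polchinski

variable {N : ℕ}

/-! ### The exchange inequality for the smoothed class -/

section Exchange

/-- A bounded continuous shift `ζ ↦ H(y+ζ)` is integrable for a finite measure. [folklore] -/
private theorem integrable_shift₃ {Y : Type*} [NormedAddCommGroup Y] {H : EuclideanSpace ℝ (Fin N) → Y}
    (hHc : Continuous H) {MH : ℝ} (hH : ∀ x, ‖H x‖ ≤ MH) (P : Measure (EuclideanSpace ℝ (Fin N)))
    [IsFiniteMeasure P] (y : EuclideanSpace ℝ (Fin N)) : Integrable (fun ζ => H (y + ζ)) P :=
  Integrable.of_bound (hHc.comp (continuous_const.add continuous_id)).aestronglyMeasurable MH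
    (Eventually.of_forall fun ζ => hH (y + ζ))

variable (D : CovDecomposition N) {Ψ V₀ F : EuclideanSpace ℝ (Fin N) → ℝ} {B BF a b c₁ c₂ : ℝ}

set_option maxHeartbeats 6000000 in
/-- **The exchange inequality, smoothed class** ([BBD] proof of Theorem 3, p0016 L130–153: the dual
identity, Lemma 1 and (e:assCt-mon)), for initial data `e^{−V₀} = Ψ` with `Ψ ∈ C⁸` positive, bounded,
`Ψ`-dominated derivatives and a Gaussian lower bound (the class of `e^{−V_s}`, `s > 0`, when `V₀` is merely
measurable and bounded below), `F ∈ C⁸(ℝ^N)` with bounded derivatives and `0 < a ≤ F ≤ b`, and the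
multiscale condition (e:assCt-mon) with rates `λ̇`: for every `t > 0` the function
`k(s) = E_{ν_s}[Σ Ċ_s^{kl} ∂_kP_{0,s}F ∂_lP_{0,s}F/(4P_{0,s}F)]` is differentiable at `t` with
`k′(t) ≤ −2λ̇_t k(t)` (`Ċ_s` read at `s ∨ 0`).  No claim about Yang–Mills is made.
[cite: BauerschmidtBodineauDagallier2023, Theorem 3 (proof)] -/
theorem hasDerivAt_renormExpect_sqrtEnergy_le_smoothed
    (hΨ : ContDiff ℝ 8 Ψ) (hB : ∀ n ≤ 8, ∀ x, ‖iteratedFDeriv ℝ n Ψ x‖ ≤ B) (hpos : ∀ x, 0 < Ψ x)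
    (hw : ∀ n ≤ 8, ∀ δ : ℝ, 0 < δ → ∃ c : ℝ, 0 ≤ c ∧
      ∀ (P : Measure (EuclideanSpace ℝ (Fin N))) [IsProbabilityMeasure P] (y : EuclideanSpace ℝ (Fin N)),
        ∫ ζ, ‖iteratedFDeriv ℝ n Ψ (y + ζ)‖ ∂P ≤ c * (∫ ζ, Ψ (y + ζ) ∂P) ^ (1 - δ))
    (hc₁ : 0 < c₁) (hc₂ : 0 ≤ c₂) (hlow : ∀ x, c₁ * Real.exp (-(c₂ * ‖x‖ ^ 2)) ≤ Ψ x)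
    (hΨV : ∀ x, Real.exp (-V₀ x) = Ψ x)
    (hF : ContDiff ℝ 8 F) (hFB : ∀ n ≤ 8, ∀ x, ‖iteratedFDeriv ℝ n F x‖ ≤ BF)
    (ha : 0 < a) (hab : ∀ x, a ≤ F x ∧ F x ≤ b)
    {lamdot : ℝ → ℝ} (hMS : MultiscaleCondition D V₀ lamdot) {t : ℝ} (ht : 0 < t) :
    ∃ k' : ℝ,
      HasDerivAt (fun s => renormExpect D V₀ s fun y =>
        (1 / 4) * ((∑ k, ∑ l, D.Cdot (max s 0) k l *
          (fderiv ℝ (semigroup D V₀ 0 s F) y (EuclideanSpace.single k 1) *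
            fderiv ℝ (semigroup D V₀ 0 s F) y (EuclideanSpace.single l 1))) *
          (semigroup D V₀ 0 s F y)⁻¹)) k' t ∧
      k' ≤ -2 * lamdot t * renormExpect D V₀ t (fun y =>
        (1 / 4) * ((∑ k, ∑ l, D.Cdot (max t 0) k l *
          (fderiv ℝ (semigroup D V₀ 0 t F) y (EuclideanSpace.single k 1) *
            fderiv ℝ (semigroup D V₀ 0 t F) y (EuclideanSpace.single l 1))) *
          (semigroup D V₀ 0 t F y)⁻¹)) := by
  classical
  ---------------------------------------------------------------- the smoothed-class data
  obtain ⟨x0⟩ : Nonempty (EuclideanSpace ℝ (Fin N)) := ⟨0⟩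
  have hΨ0 : ∀ x, 0 ≤ Ψ x := fun x => (hpos x).le
  have hΨ4 : ContDiff ℝ 4 Ψ := hΨ.of_le (by norm_num)
  have hB4 : ∀ n ≤ 4, ∀ x, ‖iteratedFDeriv ℝ n Ψ x‖ ≤ B := fun n hn => hB n (by omega)
  have hw4 : ∀ n ≤ 4, ∀ δ : ℝ, 0 < δ → ∃ c : ℝ, 0 ≤ c ∧
      ∀ (P : Measure (EuclideanSpace ℝ (Fin N))) [IsProbabilityMeasure P] (y : EuclideanSpace ℝ (Fin N)),
        ∫ ζ, ‖iteratedFDeriv ℝ n Ψ (y + ζ)‖ ∂P ≤ c * (∫ ζ, Ψ (y + ζ) ∂P) ^ (1 - δ) :=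
    fun n hn => hw n (by omega)
  have hΨc : Continuous Ψ := hΨ4.continuous
  have hΨabs : ∀ x, |Ψ x| ≤ B := Cb4.abs_le hB4
  have hΨB : ∀ x, Ψ x ≤ B := fun x => (le_abs_self _).trans (hΨabs x)
  have hBpos : 0 < B := (hpos x0).trans_le (hΨB x0)
  -- `V₀ = −log Ψ`
  have hV0 : ∀ x, V₀ x = -Real.log (Ψ x) := fun x => by
    have h := congrArg Real.log (hΨV x)
    rw [Real.log_exp] at h
    linarith
  have hVm : Measurable V₀ := by
    have he : V₀ = fun x => -Real.log (Ψ x) := funext hV0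
    rw [he]
    exact (Real.measurable_log.comp hΨc.measurable).neg
  have hb : ∀ φ, -Real.log B ≤ V₀ φ := fun φ => by
    rw [hV0]
    exact neg_le_neg (Real.log_le_log (hpos φ) (hΨB φ))
  have hexpV : (fun x => Real.exp (-V₀ x)) = Ψ := funext hΨV
  -- `F`
  have hF4 : ContDiff ℝ 4 F := hF.of_le (by norm_num)
  have hFB4 : ∀ n ≤ 4, ∀ x, ‖iteratedFDeriv ℝ n F x‖ ≤ BF := fun n hn => hFB n (by omega)
  have hFc : Continuous F := hF4.continuous
  have hFabs : ∀ x, |F x| ≤ BF := Cb4.abs_le hFB4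
  have hBF0 : 0 ≤ BF := (abs_nonneg _).trans (hFabs x0)
  have hab' : a ≤ b := (hab x0).1.trans (hab x0).2
  have hb0 : 0 ≤ b := ha.le.trans hab'
  -- `ΨF` and the partials are `Ψ`-dominated
  obtain ⟨hΨF8, hBΨF8, hwΨF8⟩ := dominated_mul (M := 8) hΨ0 hΨ hB hw hF hFB
  have hΨF4 : ContDiff ℝ 4 (fun x => Ψ x * F x) := hΨF8.of_le (by norm_num)
  have hBΨF4 : ∀ n ≤ 4, ∀ x, ‖iteratedFDeriv ℝ n (fun x => Ψ x * F x) x‖ ≤ 2 ^ 8 * B * BF :=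
    fun n hn => hBΨF8 n (by omega)
  have hwΨF4 : ∀ n ≤ 4, ∀ δ : ℝ, 0 < δ → ∃ c : ℝ, 0 ≤ c ∧
      ∀ (P : Measure (EuclideanSpace ℝ (Fin N))) [IsProbabilityMeasure P] (y : EuclideanSpace ℝ (Fin N)),
        ∫ ζ, ‖iteratedFDeriv ℝ n (fun x => Ψ x * F x) (y + ζ)‖ ∂P ≤ c * (∫ ζ, Ψ (y + ζ) ∂P) ^ (1 - δ) :=
    fun n hn => hwΨF8 n (by omega)
  have dZj := fun j : Fin N => dominated_partial (M := 7) (Ψ := Ψ) (hΨ.of_le (by norm_num))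
    (fun n hn => hB n (by omega)) (fun n hn => hw n (by omega)) (EuclideanSpace.single j 1)
  have dWj := fun j : Fin N => dominated_partial (M := 7) (Ψ := Ψ) (hΨF8.of_le (by norm_num))
    (fun n hn => hBΨF8 n (by omega)) (fun n hn => hwΨF8 n (by omega)) (EuclideanSpace.single j 1)
  have dZab := fun a' b' : Fin N => dominated_partial₂ (M := 6) (by norm_num) (Ψ := Ψ)
    (hΨ.of_le (by norm_num)) (fun n hn => hB n (by omega)) (fun n hn => hw n (by omega))
    (EuclideanSpace.single a' 1) (EuclideanSpace.single b' 1)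
  have dWab := fun a' b' : Fin N => dominated_partial₂ (M := 6) (by norm_num) (Ψ := Ψ)
    (hΨF8.of_le (by norm_num)) (fun n hn => hBΨF8 n (by omega)) (fun n hn => hwΨF8 n (by omega))
    (EuclideanSpace.single a' 1) (EuclideanSpace.single b' 1)
  have dZabk := fun k a' b' : Fin N => dominated_partial₃ (M := 5) (by norm_num) (Ψ := Ψ)
    (hΨ.of_le (by norm_num)) (fun n hn => hB n (by omega)) (fun n hn => hw n (by omega))
    (EuclideanSpace.single k 1) (EuclideanSpace.single a' 1) (EuclideanSpace.single b' 1)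
  have dWabk := fun k a' b' : Fin N => dominated_partial₃ (M := 5) (by norm_num) (Ψ := Ψ)
    (hΨF8.of_le (by norm_num)) (fun n hn => hBΨF8 n (by omega)) (fun n hn => hwΨF8 n (by omega))
    (EuclideanSpace.single k 1) (EuclideanSpace.single a' 1) (EuclideanSpace.single b' 1)
  ---------------------------------------------------------------- atoms
  set P : ℝ → Measure (EuclideanSpace ℝ (Fin N)) := fun s => multivariateGaussian 0 (D.C s) with hP_def
  haveI : ∀ s, IsProbabilityMeasure (P s) := fun s => by rw [hP_def]; infer_instance
  have hZpos : ∀ s y, 0 < ∫ ζ, Ψ (y + ζ) ∂(P s) := fun s y => smZ_pos hΨc hpos hΨB (P s) y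
  have hZle : ∀ s y, ∫ ζ, Ψ (y + ζ) ∂(P s) ≤ B := fun s y => smZ_le hΨc hpos hΨB (P s) y
  have hWmem := fun s y => smW_mem hΨc hpos hΨB hFc hab (P s) y
  have hsemi : ∀ s y, semigroup D V₀ 0 s F y =
      (∫ ζ, Ψ (y + ζ) * F (y + ζ) ∂(P s)) * (∫ ζ, Ψ (y + ζ) ∂(P s))⁻¹ := fun s y => by
    rw [semigroup_zero_eq, exp_renormPotential_eq_inv D hVm hb, mul_comm]
    simp only [hΨV, hP_def]
  have hau : ∀ s y, a ≤ (∫ ζ, Ψ (y + ζ) * F (y + ζ) ∂(P s)) * (∫ ζ, Ψ (y + ζ) ∂(P s))⁻¹ :=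
    fun s y => by
      rw [← div_eq_mul_inv, le_div_iff₀ (hZpos s y)]; exact (hWmem s y).1
  have hub : ∀ s y, (∫ ζ, Ψ (y + ζ) * F (y + ζ) ∂(P s)) * (∫ ζ, Ψ (y + ζ) ∂(P s))⁻¹ ≤ b :=
    fun s y => by
      rw [← div_eq_mul_inv, div_le_iff₀ (hZpos s y)]; exact (hWmem s y).2
  -- jet packs at every scale (for the atoms) and at scale `t`
  have pZs := fun s => sm_jpack (Ψ := Ψ) hΨ4 hB4 (P s) hw4
  have pWs := fun s => sm_jpack (Ψ := Ψ) hΨF4 hBΨF4 (P s) hwΨF4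
  have pZjs := fun s (j : Fin N) => sm_jpack (Ψ := Ψ) ((dZj j).1.of_le (by norm_num))
    (fun n hn => (dZj j).2.1 n (by omega)) (P s) (fun n hn => (dZj j).2.2 n (by omega))
  have pWjs := fun s (j : Fin N) => sm_jpack (Ψ := Ψ) ((dWj j).1.of_le (by norm_num))
    (fun n hn => (dWj j).2.1 n (by omega)) (P s) (fun n hn => (dWj j).2.2 n (by omega))
  have hZ : ∀ y, 0 < ∫ ζ, Ψ (y + ζ) ∂(P t) := hZpos t
  have hZK : ∀ y, ∫ ζ, Ψ (y + ζ) ∂(P t) ≤ B := hZle t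
  have pZ := pZs t
  have pW := pWs t
  have pZj := pZjs t
  have pWj := pWjs t
  have pZab := fun a' b' : Fin N => sm_jpack (Ψ := Ψ) ((dZab a' b').1.of_le (by norm_num))
    (fun n hn => (dZab a' b').2.1 n (by omega)) (P t) (fun n hn => (dZab a' b').2.2 n (by omega))
  have pWab := fun a' b' : Fin N => sm_jpack (Ψ := Ψ) ((dWab a' b').1.of_le (by norm_num))
    (fun n hn => (dWab a' b').2.1 n (by omega)) (P t) (fun n hn => (dWab a' b').2.2 n (by omega))
  have pZabk := fun k a' b' : Fin N => sm_jpack (Ψ := Ψ) ((dZabk k a' b').1.of_le (by norm_num))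
    (fun n hn => (dZabk k a' b').2.1 n (by omega)) (P t) (fun n hn => (dZabk k a' b').2.2 n (by omega))
  have pWabk := fun k a' b' : Fin N => sm_jpack (Ψ := Ψ) ((dWabk k a' b').1.of_le (by norm_num))
    (fun n hn => (dWabk k a' b').2.1 n (by omega)) (P t) (fun n hn => (dWabk k a' b').2.2 n (by omega))
  have hZp : (∀ x, HasFDerivAt (fun y => ∫ ζ, Ψ (y + ζ) ∂(P t)) (∫ ζ, fderiv ℝ Ψ (x + ζ) ∂(P t)) x) ∧
      (∀ x, HasFDerivAt (fun y => ∫ ζ, fderiv ℝ Ψ (y + ζ) ∂(P t))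
        (∫ ζ, fderiv ℝ (fderiv ℝ Ψ) (x + ζ) ∂(P t)) x) ∧
      (∀ δ : ℝ, 0 < δ → ∃ c : ℝ, 0 ≤ c ∧ ∀ x, ‖∫ ζ, fderiv ℝ Ψ (x + ζ) ∂(P t)‖ ≤
        c * (∫ ζ, Ψ (x + ζ) ∂(P t)) ^ (1 - δ)) ∧
      (∀ δ : ℝ, 0 < δ → ∃ c : ℝ, 0 ≤ c ∧ ∀ x, ‖∫ ζ, fderiv ℝ (fderiv ℝ Ψ) (x + ζ) ∂(P t)‖ ≤
        c * (∫ ζ, Ψ (x + ζ) ∂(P t)) ^ (1 - δ)) := ⟨pZ.1, pZ.2.1, pZ.2.2.2.1, pZ.2.2.2.2⟩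
  ---------------------------------------------------------------- evaluation identities (all scales)
  have hZ1 : ∀ s (k : Fin N) x, (∫ ζ, fderiv ℝ Ψ (x + ζ) ∂(P s)) (EuclideanSpace.single k 1) =
      ∫ ζ, fderiv ℝ Ψ (x + ζ) (EuclideanSpace.single k 1) ∂(P s) :=
    fun s k x => sm_fderiv_apply hΨ4 hB4 (P s) x _
  have hW1 : ∀ s (k : Fin N) x, (∫ ζ, fderiv ℝ (fun x => Ψ x * F x) (x + ζ) ∂(P s))
      (EuclideanSpace.single k 1) =
      ∫ ζ, fderiv ℝ (fun x => Ψ x * F x) (x + ζ) (EuclideanSpace.single k 1) ∂(P s) :=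
    fun s k x => sm_fderiv_apply hΨF4 hBΨF4 (P s) x _
  have hGk1 : ∀ (k : Fin N) x (v : EuclideanSpace ℝ (Fin N)),
      (∫ ζ, fderiv ℝ (fun x => fderiv ℝ Ψ x (EuclideanSpace.single k 1)) (x + ζ) ∂(P t)) v =
      ∫ ζ, fderiv ℝ (fderiv ℝ Ψ) (x + ζ) (EuclideanSpace.single k 1) v ∂(P t) := by
    intro k x v
    rw [sm_fderiv_apply ((dZj k).1.of_le (by norm_num)) (fun n hn => (dZj k).2.1 n (by omega)) (P t) x v]
    refine integral_congr_ae (Eventually.of_forall fun ζ => ?_)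
    show fderiv ℝ (fun x => fderiv ℝ Ψ x (EuclideanSpace.single k 1)) (x + ζ) v = _
    rw [(Cb4.hasFDerivAt_partial hΨ4 (EuclideanSpace.single k 1) (x + ζ)).fderiv]
  have hHk1 : ∀ (k : Fin N) x (v : EuclideanSpace ℝ (Fin N)),
      (∫ ζ, fderiv ℝ (fun x => fderiv ℝ (fun x => Ψ x * F x) x (EuclideanSpace.single k 1)) (x + ζ)
        ∂(P t)) v =
      ∫ ζ, fderiv ℝ (fderiv ℝ (fun x => Ψ x * F x)) (x + ζ) (EuclideanSpace.single k 1) v ∂(P t) := by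
    intro k x v
    rw [sm_fderiv_apply ((dWj k).1.of_le (by norm_num)) (fun n hn => (dWj k).2.1 n (by omega)) (P t) x v]
    refine integral_congr_ae (Eventually.of_forall fun ζ => ?_)
    show fderiv ℝ (fun x => fderiv ℝ (fun x => Ψ x * F x) x (EuclideanSpace.single k 1)) (x + ζ) v = _
    rw [(Cb4.hasFDerivAt_partial hΨF4 (EuclideanSpace.single k 1) (x + ζ)).fderiv]
  have hZ2 : ∀ (i j : Fin N) x,
      (∫ ζ, fderiv ℝ (fderiv ℝ Ψ) (x + ζ) ∂(P t)) (EuclideanSpace.single i 1) (EuclideanSpace.single j 1) =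
      (∫ ζ, fderiv ℝ (fun x => fderiv ℝ Ψ x (EuclideanSpace.single j 1)) (x + ζ) ∂(P t))
        (EuclideanSpace.single i 1) := fun i j x => by
    rw [sm_fderiv₂_apply hΨ4 hB4, hGk1, sm_fderiv₂_symm hΨ4]
  have hW2 : ∀ (i j : Fin N) x,
      (∫ ζ, fderiv ℝ (fderiv ℝ (fun x => Ψ x * F x)) (x + ζ) ∂(P t)) (EuclideanSpace.single i 1)
        (EuclideanSpace.single j 1) =
      (∫ ζ, fderiv ℝ (fun x => fderiv ℝ (fun x => Ψ x * F x) x (EuclideanSpace.single j 1)) (x + ζ)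
        ∂(P t)) (EuclideanSpace.single i 1) := fun i j x => by
    rw [sm_fderiv₂_apply hΨF4 hBΨF4, hHk1, sm_fderiv₂_symm hΨF4]
  have hZ2s : ∀ (i j : Fin N) x,
      (∫ ζ, fderiv ℝ (fun x => fderiv ℝ Ψ x (EuclideanSpace.single j 1)) (x + ζ) ∂(P t))
        (EuclideanSpace.single i 1) =
      (∫ ζ, fderiv ℝ (fun x => fderiv ℝ Ψ x (EuclideanSpace.single i 1)) (x + ζ) ∂(P t))
        (EuclideanSpace.single j 1) := fun i j x => by
    rw [hGk1, hGk1, sm_fderiv₂_symm hΨ4]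
  have hW2s : ∀ (i j : Fin N) x,
      (∫ ζ, fderiv ℝ (fun x => fderiv ℝ (fun x => Ψ x * F x) x (EuclideanSpace.single j 1)) (x + ζ)
        ∂(P t)) (EuclideanSpace.single i 1) =
      (∫ ζ, fderiv ℝ (fun x => fderiv ℝ (fun x => Ψ x * F x) x (EuclideanSpace.single i 1)) (x + ζ)
        ∂(P t)) (EuclideanSpace.single j 1) := fun i j x => by
    rw [hHk1, hHk1, sm_fderiv₂_symm hΨF4]
  have hZ11 : ∀ (k j : Fin N) x,
      (∫ ζ, fderiv ℝ (fun x => fderiv ℝ Ψ x (EuclideanSpace.single k 1)) (x + ζ) ∂(P t))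
        (EuclideanSpace.single j 1) =
      ∫ ζ, fderiv ℝ (fderiv ℝ Ψ) (x + ζ) (EuclideanSpace.single k 1) (EuclideanSpace.single j 1) ∂(P t) :=
    fun k j x => hGk1 k x _
  have hW11 : ∀ (k j : Fin N) x,
      (∫ ζ, fderiv ℝ (fun x => fderiv ℝ (fun x => Ψ x * F x) x (EuclideanSpace.single k 1)) (x + ζ)
        ∂(P t)) (EuclideanSpace.single j 1) =
      ∫ ζ, fderiv ℝ (fderiv ℝ (fun x => Ψ x * F x)) (x + ζ) (EuclideanSpace.single k 1)
        (EuclideanSpace.single j 1) ∂(P t) :=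
    fun k j x => hHk1 k x _
  ---------------------------------------------------------------- `Ċ_{s∨0}` and its derivative at `t`
  obtain ⟨KC, hKC⟩ := D.bounded_Cdot
  set Cf : ℝ → Matrix (Fin N) (Fin N) ℝ := fun s => D.Cdot (max s 0) with hCf_def
  have hmax : max t 0 = t := max_eq_left ht.le
  have bC : ∀ s k l, |Cf s k l| ≤ KC := fun s k l => hKC (max s 0) (le_max_right _ _) k l
  have sC : ∀ k l, HasDerivAt (fun s => Cf s k l) (D.Cddot t k l) t := fun k l => by
    refine (D.hasDerivAt_Cdot t ht.le k l).congr_of_eventuallyEq ?_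
    filter_upwards [lt_mem_nhds ht] with s hs
    simp only [hCf_def, max_eq_left hs.le]
  have hCs : ∀ k l, Cf t l k = Cf t k l := fun k l => D.Cdot_symm (le_max_right t 0) k l
  have hCpsd : (Cf t).PosSemidef := D.posSemidef_Cdot (max t 0) (le_max_right _ _)
  have hCft : Cf t = D.Cdot t := by simp only [hCf_def, hmax]
  ---------------------------------------------------------------- the `G`-level objects at scale `t`
  set u : EuclideanSpace ℝ (Fin N) → ℝ := fun y =>
    (∫ ζ, Ψ (y + ζ) * F (y + ζ) ∂(P t)) * (∫ ζ, Ψ (y + ζ) ∂(P t))⁻¹ with hu_def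
  set g : Fin N → EuclideanSpace ℝ (Fin N) → ℝ := fun k y =>
    (∫ ζ, fderiv ℝ (fun x => Ψ x * F x) (y + ζ) (EuclideanSpace.single k 1) ∂(P t)) *
        (∫ ζ, Ψ (y + ζ) ∂(P t))⁻¹ -
      (∫ ζ, Ψ (y + ζ) * F (y + ζ) ∂(P t)) * (∫ ζ, Ψ (y + ζ) ∂(P t))⁻¹ *
        ((∫ ζ, fderiv ℝ Ψ (y + ζ) (EuclideanSpace.single k 1) ∂(P t)) * (∫ ζ, Ψ (y + ζ) ∂(P t))⁻¹)
    with hg_def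
  set A : EuclideanSpace ℝ (Fin N) → ℝ := fun y => ∑ k, ∑ l, Cf t k l * (g k y * g l y) with hA_def
  set H : EuclideanSpace ℝ (Fin N) → ℝ := fun y => (1 / 4) * (A y * (u y)⁻¹) with hH_def
  -- slopes of the atoms
  set Zd : EuclideanSpace ℝ (Fin N) → ℝ := fun y => (1 / 2) * ∑ a', ∑ b', D.Cdot t a' b' *
    ∫ ζ, fderiv ℝ (fderiv ℝ Ψ) (y + ζ) (EuclideanSpace.single a' 1) (EuclideanSpace.single b' 1) ∂(P t)
    with hZd_def
  set Wd : EuclideanSpace ℝ (Fin N) → ℝ := fun y => (1 / 2) * ∑ a', ∑ b', D.Cdot t a' b' *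
    ∫ ζ, fderiv ℝ (fderiv ℝ (fun x => Ψ x * F x)) (y + ζ) (EuclideanSpace.single a' 1)
      (EuclideanSpace.single b' 1) ∂(P t) with hWd_def
  set Z1d : Fin N → EuclideanSpace ℝ (Fin N) → ℝ := fun k y => (1 / 2) * ∑ a', ∑ b', D.Cdot t a' b' *
    ∫ ζ, fderiv ℝ (fderiv ℝ (fderiv ℝ Ψ)) (y + ζ) (EuclideanSpace.single k 1)
      (EuclideanSpace.single a' 1) (EuclideanSpace.single b' 1) ∂(P t) with hZ1d_def
  set W1d : Fin N → EuclideanSpace ℝ (Fin N) → ℝ := fun k y => (1 / 2) * ∑ a', ∑ b', D.Cdot t a' b' *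
    ∫ ζ, fderiv ℝ (fderiv ℝ (fderiv ℝ (fun x => Ψ x * F x))) (y + ζ) (EuclideanSpace.single k 1)
      (EuclideanSpace.single a' 1) (EuclideanSpace.single b' 1) ∂(P t) with hW1d_def
  -- slopes of the `G`-level objects (product forms)
  set ud : EuclideanSpace ℝ (Fin N) → ℝ := fun y =>
    Wd y * (∫ ζ, Ψ (y + ζ) ∂(P t))⁻¹ -
      (∫ ζ, Ψ (y + ζ) * F (y + ζ) ∂(P t)) * (∫ ζ, Ψ (y + ζ) ∂(P t))⁻¹ *
        (Zd y * (∫ ζ, Ψ (y + ζ) ∂(P t))⁻¹) with hud_def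
  set gd : Fin N → EuclideanSpace ℝ (Fin N) → ℝ := fun k y =>
    W1d k y * (∫ ζ, Ψ (y + ζ) ∂(P t))⁻¹ -
      (∫ ζ, fderiv ℝ (fun x => Ψ x * F x) (y + ζ) (EuclideanSpace.single k 1) ∂(P t)) *
        (∫ ζ, Ψ (y + ζ) ∂(P t))⁻¹ * (Zd y * (∫ ζ, Ψ (y + ζ) ∂(P t))⁻¹) -
      Wd y * (∫ ζ, Ψ (y + ζ) ∂(P t))⁻¹ *
        ((∫ ζ, fderiv ℝ Ψ (y + ζ) (EuclideanSpace.single k 1) ∂(P t)) * (∫ ζ, Ψ (y + ζ) ∂(P t))⁻¹) -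
      (∫ ζ, Ψ (y + ζ) * F (y + ζ) ∂(P t)) * (∫ ζ, Ψ (y + ζ) ∂(P t))⁻¹ *
        (Z1d k y * (∫ ζ, Ψ (y + ζ) ∂(P t))⁻¹) +
      2 * ((∫ ζ, Ψ (y + ζ) * F (y + ζ) ∂(P t)) * (∫ ζ, Ψ (y + ζ) ∂(P t))⁻¹ *
        ((∫ ζ, fderiv ℝ Ψ (y + ζ) (EuclideanSpace.single k 1) ∂(P t)) * (∫ ζ, Ψ (y + ζ) ∂(P t))⁻¹) *
        (Zd y * (∫ ζ, Ψ (y + ζ) ∂(P t))⁻¹)) with hgd_def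
  set Ad : EuclideanSpace ℝ (Fin N) → ℝ := fun y =>
    2 * (∑ k, ∑ l, Cf t k l * (gd k y * g l y)) + ∑ k, ∑ l, D.Cddot t k l * (g k y * g l y) with hAd_def
  set Hd : EuclideanSpace ℝ (Fin N) → ℝ := fun y =>
    (1 / 4) * (Ad y * (u y)⁻¹) - (1 / 4) * (A y * ud y * ((u y)⁻¹ * (u y)⁻¹)) with hHd_def
  ---------------------------------------------------------------- tame packs of these objects
  have haut : ∀ y, a ≤ u y := fun y => hau t y
  obtain ⟨Du, D2u, pu, hDu, hD2u⟩ := quotient_tjets hZ pZ pW u (fun y => rfl)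
  have hgk := fun k : Fin N => gradQuotient_tjets hZ pZ pW (pZj k) (pWj k) (g k) (fun y => rfl)
  choose Dg D2g pg hDg hD2g using hgk
  obtain ⟨DA, D2A, pA, hDA, hD2A⟩ := quadForm_tjets hZ pg (Cf t) A (fun y => rfl)
  have pIu := tpack_inv hZ hZK pu ha haut
  have pZd := jpack_const_mul (1 / 2 : ℝ) (jpack_sum Finset.univ fun a' _ =>
    jpack_sum Finset.univ fun b' _ => jpack_const_mul (D.Cdot t a' b') (pZab a' b'))
  have pWd := jpack_const_mul (1 / 2 : ℝ) (jpack_sum Finset.univ fun a' _ =>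
    jpack_sum Finset.univ fun b' _ => jpack_const_mul (D.Cdot t a' b') (pWab a' b'))
  have pZ1d := fun k : Fin N => jpack_const_mul (1 / 2 : ℝ) (jpack_sum Finset.univ fun a' _ =>
    jpack_sum Finset.univ fun b' _ => jpack_const_mul (D.Cdot t a' b') (pZabk k a' b'))
  have pW1d := fun k : Fin N => jpack_const_mul (1 / 2 : ℝ) (jpack_sum Finset.univ fun a' _ =>
    jpack_sum Finset.univ fun b' _ => jpack_const_mul (D.Cdot t a' b') (pWabk k a' b'))
  have qW := tpack_of_jpack_div hZ hZp pW
  have qZj := fun k => tpack_of_jpack_div hZ hZp (pZj k)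
  have qWj := fun k => tpack_of_jpack_div hZ hZp (pWj k)
  have qZd := tpack_of_jpack_div hZ hZp pZd
  have qWd := tpack_of_jpack_div hZ hZp pWd
  have qZ1d := fun k => tpack_of_jpack_div hZ hZp (pZ1d k)
  have qW1d := fun k => tpack_of_jpack_div hZ hZp (pW1d k)
  have pud := tpack_sub qWd (tpack_mul hZ qW qZd)
  have pgd := fun k => tpack_add
    (tpack_sub (tpack_sub (tpack_sub (qW1d k) (tpack_mul hZ (qWj k) qZd)) (tpack_mul hZ qWd (qZj k)))
      (tpack_mul hZ qW (qZ1d k)))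
    (tpack_const_mul (2 : ℝ) (tpack_mul hZ (tpack_mul hZ qW (qZj k)) qZd))
  have pAd := tpack_add
    (tpack_const_mul (2 : ℝ) (tpack_sum Finset.univ fun k _ => tpack_sum Finset.univ fun l _ =>
      tpack_const_mul (Cf t k l) (tpack_mul hZ (pgd k) (pg l))))
    (tpack_sum Finset.univ fun k _ => tpack_sum Finset.univ fun l _ =>
      tpack_const_mul (D.Cddot t k l) (tpack_mul hZ (pg k) (pg l)))
  have pHd := tpack_sub (tpack_const_mul (1 / 4 : ℝ) (tpack_mul hZ pAd pIu))
    (tpack_const_mul (1 / 4 : ℝ) (tpack_mul hZ (tpack_mul hZ pA pud) (tpack_mul hZ pIu pIu)))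
  ---------------------------------------------------------------- the multiscale condition at a point
  have hG1 : ∀ x, HasFDerivAt (fun x => Real.exp (-V₀ x)) (fderiv ℝ Ψ x) x := by
    rw [hexpV]; exact Cb4.hasFDerivAt hΨ4
  have hG2 : ∀ x, HasFDerivAt (fderiv ℝ Ψ) (fderiv ℝ (fderiv ℝ Ψ) x) x := Cb4.hasFDerivAt_fderiv hΨ4
  have hms : ∀ x, lamdot t * ((fun k => g k x) ⬝ᵥ (Cf t *ᵥ fun k => g k x)) ≤
      (Cf t *ᵥ fun k => g k x) ⬝ᵥ
          ((Matrix.of fun i k : Fin N =>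
            -((∫ ζ, fderiv ℝ (fun x => fderiv ℝ Ψ x (EuclideanSpace.single i 1)) (x + ζ) ∂(P t))
                (EuclideanSpace.single k 1)) / (∫ ζ, Ψ (x + ζ) ∂(P t)) +
              (∫ ζ, fderiv ℝ Ψ (x + ζ) (EuclideanSpace.single i 1) ∂(P t)) *
                (∫ ζ, fderiv ℝ Ψ (x + ζ) (EuclideanSpace.single k 1) ∂(P t)) /
                (∫ ζ, Ψ (x + ζ) ∂(P t)) ^ 2) *ᵥ (Cf t *ᵥ fun k => g k x)) -
        (1 / 2) * ((fun k => g k x) ⬝ᵥ (D.Cddot t *ᵥ fun k => g k x)) := by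
    intro x
    have h := multiscale_jet D hG1 hG2 hb (Cb4.norm_fderiv_le hB4) (Cb4.norm_fderiv₂_le hB4)
      (Cb4.uniformContinuous_fderiv₂ hΨ4 hB4).continuous hMS ht x (fun k => g k x)
    simp only [hΨV, sm_fderiv₂_apply hΨ4 hB4, sm_fderiv_apply hΨ4 hB4] at h
    simp only [hCft, hZ11]
    exact h
  -- second derivatives of the first partials are third derivatives
  have hfG2 : ∀ (k : Fin N) y, fderiv ℝ (fderiv ℝ (fun x => fderiv ℝ Ψ x (EuclideanSpace.single k 1))) y =
      fderiv ℝ (fderiv ℝ (fderiv ℝ Ψ)) y (EuclideanSpace.single k 1) := by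
    intro k y
    have hfG : fderiv ℝ (fun x => fderiv ℝ Ψ x (EuclideanSpace.single k 1)) =
        fun y => fderiv ℝ (fderiv ℝ Ψ) y (EuclideanSpace.single k 1) :=
      funext fun y => (Cb4.hasFDerivAt_partial hΨ4 _ y).fderiv
    rw [hfG]
    exact (Cb4.hasFDerivAt_fderiv_partial hΨ4 _ y).fderiv
  have hfH2 : ∀ (k : Fin N) y,
      fderiv ℝ (fderiv ℝ (fun x => fderiv ℝ (fun x => Ψ x * F x) x (EuclideanSpace.single k 1))) y =
      fderiv ℝ (fderiv ℝ (fderiv ℝ (fun x => Ψ x * F x))) y (EuclideanSpace.single k 1) := by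
    intro k y
    have hfH : fderiv ℝ (fun x => fderiv ℝ (fun x => Ψ x * F x) x (EuclideanSpace.single k 1)) =
        fun y => fderiv ℝ (fderiv ℝ (fun x => Ψ x * F x)) y (EuclideanSpace.single k 1) :=
      funext fun y => (Cb4.hasFDerivAt_partial hΨF4 _ y).fderiv
    rw [hfH]
    exact (Cb4.hasFDerivAt_fderiv_partial hΨF4 _ y).fderiv
  ---------------------------------------------------------------- Lemma 1 with tame jets
  obtain ⟨DH, D2H, pH, hHj, hineq⟩ := sqrtGradient_texchange hZ hZK pZ pW pZj pWj
    (Z11 := fun k j x => ∫ ζ, fderiv ℝ (fderiv ℝ Ψ) (x + ζ) (EuclideanSpace.single k 1)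
      (EuclideanSpace.single j 1) ∂(P t))
    (W11 := fun k j x => ∫ ζ, fderiv ℝ (fderiv ℝ (fun x => Ψ x * F x)) (x + ζ)
      (EuclideanSpace.single k 1) (EuclideanSpace.single j 1) ∂(P t))
    pZab pWab hZ11 hW11 (fun k x => hZ1 t k x) (fun k x => hW1 t k x) hZ2 hW2 hZ2s hW2s ha
    (fun x => (hWmem t x).1) hCpsd hCs (lam := lamdot t) u (fun x => rfl) g (fun k x => rfl)
    A (fun x => rfl) H (fun x => rfl) Zd Wd Z1d W1d
    (fun x => by
      simp only [hZd_def, hCft]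
      refine congrArg _ (Finset.sum_congr rfl fun i _ => Finset.sum_congr rfl fun j _ => ?_)
      rw [hZ11, sm_fderiv₂_symm hΨ4])
    (fun x => by
      simp only [hWd_def, hCft]
      refine congrArg _ (Finset.sum_congr rfl fun i _ => Finset.sum_congr rfl fun j _ => ?_)
      rw [hW11, sm_fderiv₂_symm hΨF4])
    (fun k x => by
      simp only [hZ1d_def, hCft]
      refine congrArg _ (Finset.sum_congr rfl fun i _ => Finset.sum_congr rfl fun j _ => ?_)
      rw [sm_fderiv₂_apply ((dZj k).1.of_le (by norm_num)) (fun n hn => (dZj k).2.1 n (by omega))]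
      refine congrArg _ (integral_congr_ae (Eventually.of_forall fun ζ => ?_))
      show _ = fderiv ℝ (fderiv ℝ (fun x => fderiv ℝ Ψ x (EuclideanSpace.single k 1))) (x + ζ) _ _
      rw [hfG2])
    (fun k x => by
      simp only [hW1d_def, hCft]
      refine congrArg _ (Finset.sum_congr rfl fun i _ => Finset.sum_congr rfl fun j _ => ?_)
      rw [sm_fderiv₂_apply ((dWj k).1.of_le (by norm_num)) (fun n hn => (dWj k).2.1 n (by omega))]
      refine congrArg _ (integral_congr_ae (Eventually.of_forall fun ζ => ?_))
      show _ = fderiv ℝ (fderiv ℝ (fun x => fderiv ℝ (fun x => Ψ x * F x) x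
        (EuclideanSpace.single k 1))) (x + ζ) _ _
      rw [hfH2])
    ud (fun x => by simp only [hud_def]; ring) gd (fun k x => by simp only [hgd_def]; ring)
    Ad (fun x => rfl) Hd (fun x => by simp only [hHd_def]; ring) hms
  ---------------------------------------------------------------- the weighted family `K_s = Z_s H_s`
  set K : ℝ → EuclideanSpace ℝ (Fin N) → ℝ := fun s y =>
    (∫ ζ, Ψ (y + ζ) ∂(P s)) * ((1 / 4) * ((∑ k, ∑ l, Cf s k l *
      (((∫ ζ, fderiv ℝ (fun x => Ψ x * F x) (y + ζ) (EuclideanSpace.single k 1) ∂(P s)) *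
            (∫ ζ, Ψ (y + ζ) ∂(P s))⁻¹ -
          (∫ ζ, Ψ (y + ζ) * F (y + ζ) ∂(P s)) * (∫ ζ, Ψ (y + ζ) ∂(P s))⁻¹ *
            ((∫ ζ, fderiv ℝ Ψ (y + ζ) (EuclideanSpace.single k 1) ∂(P s)) * (∫ ζ, Ψ (y + ζ) ∂(P s))⁻¹)) *
        ((∫ ζ, fderiv ℝ (fun x => Ψ x * F x) (y + ζ) (EuclideanSpace.single l 1) ∂(P s)) *
            (∫ ζ, Ψ (y + ζ) ∂(P s))⁻¹ -
          (∫ ζ, Ψ (y + ζ) * F (y + ζ) ∂(P s)) * (∫ ζ, Ψ (y + ζ) ∂(P s))⁻¹ *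
            ((∫ ζ, fderiv ℝ Ψ (y + ζ) (EuclideanSpace.single l 1) ∂(P s)) * (∫ ζ, Ψ (y + ζ) ∂(P s))⁻¹)))) *
      ((∫ ζ, Ψ (y + ζ) * F (y + ζ) ∂(P s)) * (∫ ζ, Ψ (y + ζ) ∂(P s))⁻¹)⁻¹)) with hK_def
  have hKt : K t = fun y => (∫ ζ, Ψ (y + ζ) ∂(P t)) * H y := by
    funext y; simp only [hK_def, hH_def, hA_def, hg_def, hu_def]
  have pK := jpack_mul_tpack hZ pZ pH
  -- `∂_j K_t = Z_j H + Z ∂_jH`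
  choose Hj Hj1 Hj2 pHj hHjeq using hHj
  have pKj := fun j : Fin N => jpack_add (jpack_mul_tpack hZ (pZj j) pH) (jpack_mul_tpack hZ pZ (pHj j))
  have hKj : ∀ (j : Fin N) y,
      ((∫ ζ, Ψ (y + ζ) ∂(P t)) • DH y + H y • ∫ ζ, fderiv ℝ Ψ (y + ζ) ∂(P t)) (EuclideanSpace.single j 1) =
      (∫ ζ, fderiv ℝ Ψ (y + ζ) (EuclideanSpace.single j 1) ∂(P t)) * H y +
        (∫ ζ, Ψ (y + ζ) ∂(P t)) * Hj j y := by
    intro j y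
    simp only [_root_.add_apply, _root_.smul_apply, smul_eq_mul, hZ1, hHjeq]
    ring
  have hUCK := uniformContinuous_of_partial_packs pK.2.1 hKj (fun j => (pKj j).1)
    (fun j => (pKj j).2.1) (fun j => by
      obtain ⟨L, -, hL⟩ := bounded_of_jet (pKj j).2.2.2.2
      exact ⟨L, hL⟩) pK.1
  obtain ⟨MK, -, hMK⟩ := bounded_of_jet pK.2.2.2.2
  ---------------------------------------------------------------- continuity and uniform bound of `K_s`
  have hKc : ∀ s, Continuous (K s) := by
    intro s
    have cZ : Continuous fun y => ∫ ζ, Ψ (y + ζ) ∂(P s) :=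
      continuous_iff_continuousAt.2 fun y => ((pZs s).1 y).continuousAt
    have cW : Continuous fun y => ∫ ζ, Ψ (y + ζ) * F (y + ζ) ∂(P s) :=
      continuous_iff_continuousAt.2 fun y => ((pWs s).1 y).continuousAt
    have cZ1 : ∀ k : Fin N, Continuous fun y =>
        ∫ ζ, fderiv ℝ Ψ (y + ζ) (EuclideanSpace.single k 1) ∂(P s) :=
      fun k => continuous_iff_continuousAt.2 fun y => ((pZjs s k).1 y).continuousAt
    have cW1 : ∀ k : Fin N, Continuous fun y =>
        ∫ ζ, fderiv ℝ (fun x => Ψ x * F x) (y + ζ) (EuclideanSpace.single k 1) ∂(P s) :=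
      fun k => continuous_iff_continuousAt.2 fun y => ((pWjs s k).1 y).continuousAt
    have cIZ : Continuous fun y => (∫ ζ, Ψ (y + ζ) ∂(P s))⁻¹ := cZ.inv₀ fun y => (hZpos s y).ne'
    have cu : Continuous fun y => (∫ ζ, Ψ (y + ζ) * F (y + ζ) ∂(P s)) * (∫ ζ, Ψ (y + ζ) ∂(P s))⁻¹ :=
      cW.mul cIZ
    have cIu : Continuous fun y =>
        ((∫ ζ, Ψ (y + ζ) * F (y + ζ) ∂(P s)) * (∫ ζ, Ψ (y + ζ) ∂(P s))⁻¹)⁻¹ :=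
      cu.inv₀ fun y => (ha.trans_le (hau s y)).ne'
    have cg : ∀ k : Fin N, Continuous fun y =>
        (∫ ζ, fderiv ℝ (fun x => Ψ x * F x) (y + ζ) (EuclideanSpace.single k 1) ∂(P s)) *
            (∫ ζ, Ψ (y + ζ) ∂(P s))⁻¹ -
          (∫ ζ, Ψ (y + ζ) * F (y + ζ) ∂(P s)) * (∫ ζ, Ψ (y + ζ) ∂(P s))⁻¹ *
            ((∫ ζ, fderiv ℝ Ψ (y + ζ) (EuclideanSpace.single k 1) ∂(P s)) * (∫ ζ, Ψ (y + ζ) ∂(P s))⁻¹) :=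
      fun k => ((cW1 k).mul cIZ).sub (cu.mul ((cZ1 k).mul cIZ))
    simp only [hK_def]
    exact cZ.mul (continuous_const.mul ((continuous_finsetSum _ fun k _ =>
      continuous_finsetSum _ fun l _ => continuous_const.mul ((cg k).mul (cg l))).mul cIu))
  -- P-uniform jet bounds of the first jets (every `δ > 0`; `δ = 1/2` for the uniform bound below)
  have bZ1δ : ∀ δ : ℝ, 0 < δ → ∃ c : ℝ, 0 ≤ c ∧ ∀ s (k : Fin N) y,
      |∫ ζ, fderiv ℝ Ψ (y + ζ) (EuclideanSpace.single k 1) ∂(P s)| ≤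
        c * (∫ ζ, Ψ (y + ζ) ∂(P s)) ^ (1 - δ) := by
    intro δ hδ
    obtain ⟨c, hc0, hc⟩ := hw 1 (by norm_num) δ hδ
    refine ⟨c, hc0, fun s k y => ?_⟩
    rw [← Real.norm_eq_abs]
    refine (norm_integral_le_of_norm_le ((integrable_shift₃ (hΨ4.continuous_iteratedFDeriv
      (by norm_num)) (hB4 1 (by norm_num)) (P s) y).norm) (Eventually.of_forall fun ζ => ?_)).trans
      (hc (P s) y)
    rw [Real.norm_eq_abs, ← Cb4.norm_fderiv_eq_norm_iteratedFDeriv_one]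
    calc |fderiv ℝ Ψ (y + ζ) (EuclideanSpace.single k 1)|
        ≤ ‖fderiv ℝ Ψ (y + ζ)‖ * ‖(EuclideanSpace.single k (1 : ℝ))‖ := by
          rw [← Real.norm_eq_abs]; exact ContinuousLinearMap.le_opNorm _ _
      _ = ‖fderiv ℝ Ψ (y + ζ)‖ := by rw [Cb4.norm_single_one, mul_one]
  have bW1δ : ∀ δ : ℝ, 0 < δ → ∃ c : ℝ, 0 ≤ c ∧ ∀ s (k : Fin N) y,
      |∫ ζ, fderiv ℝ (fun x => Ψ x * F x) (y + ζ) (EuclideanSpace.single k 1) ∂(P s)| ≤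
        c * (∫ ζ, Ψ (y + ζ) ∂(P s)) ^ (1 - δ) := by
    intro δ hδ
    obtain ⟨c, hc0, hc⟩ := hwΨF8 1 (by norm_num) δ hδ
    refine ⟨c, hc0, fun s k y => ?_⟩
    rw [← Real.norm_eq_abs]
    refine (norm_integral_le_of_norm_le ((integrable_shift₃ (hΨF4.continuous_iteratedFDeriv
      (by norm_num)) (hBΨF4 1 (by norm_num)) (P s) y).norm) (Eventually.of_forall fun ζ => ?_)).trans
      (hc (P s) y)
    rw [Real.norm_eq_abs, ← Cb4.norm_fderiv_eq_norm_iteratedFDeriv_one]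
    calc |fderiv ℝ (fun x => Ψ x * F x) (y + ζ) (EuclideanSpace.single k 1)|
        ≤ ‖fderiv ℝ (fun x => Ψ x * F x) (y + ζ)‖ * ‖(EuclideanSpace.single k (1 : ℝ))‖ := by
          rw [← Real.norm_eq_abs]; exact ContinuousLinearMap.le_opNorm _ _
      _ = ‖fderiv ℝ (fun x => Ψ x * F x) (y + ζ)‖ := by rw [Cb4.norm_single_one, mul_one]
  obtain ⟨cZ1, hcZ10, bZ1⟩ := bZ1δ (1 / 2) (by norm_num)
  obtain ⟨cW1, hcW10, bW1⟩ := bW1δ (1 / 2) (by norm_num)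
  -- sup bounds of the first jets (from `δ = 1/2` and `Z ≤ B`)
  have bZ1sup : ∀ s (k : Fin N) y, |∫ ζ, fderiv ℝ Ψ (y + ζ) (EuclideanSpace.single k 1) ∂(P s)| ≤
      cZ1 * B ^ (1 - 1 / 2 : ℝ) := fun s k y =>
    (bZ1 s k y).trans (mul_le_mul_of_nonneg_left (Real.rpow_le_rpow (hZpos s y).le (hZle s y)
      (by norm_num)) hcZ10)
  have bW1sup : ∀ s (k : Fin N) y,
      |∫ ζ, fderiv ℝ (fun x => Ψ x * F x) (y + ζ) (EuclideanSpace.single k 1) ∂(P s)| ≤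
      cW1 * B ^ (1 - 1 / 2 : ℝ) := fun s k y =>
    (bW1 s k y).trans (mul_le_mul_of_nonneg_left (Real.rpow_le_rpow (hZpos s y).le (hZle s y)
      (by norm_num)) hcW10)
  -- `|Z_s g_k| ≤ (c_W + b c_Z) Z_s^{1/2}` and the uniform bound on `K_s`
  set cn : ℝ := cW1 + b * cZ1 with hcn
  have hcn0 : 0 ≤ cn := by positivity
  have bn : ∀ s (k : Fin N) y,
      |(∫ ζ, fderiv ℝ (fun x => Ψ x * F x) (y + ζ) (EuclideanSpace.single k 1) ∂(P s)) -
        (∫ ζ, Ψ (y + ζ) * F (y + ζ) ∂(P s)) * (∫ ζ, Ψ (y + ζ) ∂(P s))⁻¹ *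
          ∫ ζ, fderiv ℝ Ψ (y + ζ) (EuclideanSpace.single k 1) ∂(P s)| ≤
      cn * (∫ ζ, Ψ (y + ζ) ∂(P s)) ^ (1 - 1 / 2 : ℝ) := by
    intro s k y
    have hu0 : 0 ≤ (∫ ζ, Ψ (y + ζ) * F (y + ζ) ∂(P s)) * (∫ ζ, Ψ (y + ζ) ∂(P s))⁻¹ :=
      ha.le.trans (hau s y)
    calc _ ≤ |∫ ζ, fderiv ℝ (fun x => Ψ x * F x) (y + ζ) (EuclideanSpace.single k 1) ∂(P s)| +
          |(∫ ζ, Ψ (y + ζ) * F (y + ζ) ∂(P s)) * (∫ ζ, Ψ (y + ζ) ∂(P s))⁻¹ *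
            ∫ ζ, fderiv ℝ Ψ (y + ζ) (EuclideanSpace.single k 1) ∂(P s)| := abs_sub _ _
      _ ≤ cW1 * (∫ ζ, Ψ (y + ζ) ∂(P s)) ^ (1 - 1 / 2 : ℝ) +
          b * (cZ1 * (∫ ζ, Ψ (y + ζ) ∂(P s)) ^ (1 - 1 / 2 : ℝ)) := by
          refine add_le_add (bW1 s k y) ?_
          rw [abs_mul, abs_of_nonneg hu0]
          exact mul_le_mul (hub s y) (bZ1 s k y) (abs_nonneg _) hb0
      _ = cn * (∫ ζ, Ψ (y + ζ) ∂(P s)) ^ (1 - 1 / 2 : ℝ) := by rw [hcn]; ring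
  have bC' : ∀ s k l, |Cf s k l| ≤ |KC| := fun s k l => (bC s k l).trans (le_abs_self KC)
  set K0 : ℝ := (1 / 4) * (∑ k : Fin N, ∑ l : Fin N, |KC| * cn ^ 2) * a⁻¹ with hK0
  have hKb : ∀ s y, |K s y| ≤ K0 := by
    intro s y
    set Zs : ℝ := ∫ ζ, Ψ (y + ζ) ∂(P s) with hZs
    set Ws : ℝ := ∫ ζ, Ψ (y + ζ) * F (y + ζ) ∂(P s) with hWs
    have hZs0 : 0 < Zs := hZpos s y
    have hus : a ≤ Ws * Zs⁻¹ := hau s y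
    have hus0 : 0 < Ws * Zs⁻¹ := ha.trans_le hus
    have hsq : Zs ^ (1 - 1 / 2 : ℝ) * Zs ^ (1 - 1 / 2 : ℝ) = Zs := by
      rw [← Real.rpow_add hZs0]; norm_num
    -- `|g_k g_l| ≤ cn² / Z_s`
    have hgg : ∀ k l : Fin N,
        |((∫ ζ, fderiv ℝ (fun x => Ψ x * F x) (y + ζ) (EuclideanSpace.single k 1) ∂(P s)) * Zs⁻¹ -
            Ws * Zs⁻¹ * ((∫ ζ, fderiv ℝ Ψ (y + ζ) (EuclideanSpace.single k 1) ∂(P s)) * Zs⁻¹)) *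
          ((∫ ζ, fderiv ℝ (fun x => Ψ x * F x) (y + ζ) (EuclideanSpace.single l 1) ∂(P s)) * Zs⁻¹ -
            Ws * Zs⁻¹ * ((∫ ζ, fderiv ℝ Ψ (y + ζ) (EuclideanSpace.single l 1) ∂(P s)) * Zs⁻¹))| ≤
        cn ^ 2 * Zs⁻¹ := by
      intro k l
      have ek : (∫ ζ, fderiv ℝ (fun x => Ψ x * F x) (y + ζ) (EuclideanSpace.single k 1) ∂(P s)) * Zs⁻¹ -
          Ws * Zs⁻¹ * ((∫ ζ, fderiv ℝ Ψ (y + ζ) (EuclideanSpace.single k 1) ∂(P s)) * Zs⁻¹) =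
          ((∫ ζ, fderiv ℝ (fun x => Ψ x * F x) (y + ζ) (EuclideanSpace.single k 1) ∂(P s)) -
            Ws * Zs⁻¹ * ∫ ζ, fderiv ℝ Ψ (y + ζ) (EuclideanSpace.single k 1) ∂(P s)) * Zs⁻¹ := by ring
      have el : (∫ ζ, fderiv ℝ (fun x => Ψ x * F x) (y + ζ) (EuclideanSpace.single l 1) ∂(P s)) * Zs⁻¹ -
          Ws * Zs⁻¹ * ((∫ ζ, fderiv ℝ Ψ (y + ζ) (EuclideanSpace.single l 1) ∂(P s)) * Zs⁻¹) =
          ((∫ ζ, fderiv ℝ (fun x => Ψ x * F x) (y + ζ) (EuclideanSpace.single l 1) ∂(P s)) -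
            Ws * Zs⁻¹ * ∫ ζ, fderiv ℝ Ψ (y + ζ) (EuclideanSpace.single l 1) ∂(P s)) * Zs⁻¹ := by ring
      rw [ek, el, abs_mul, abs_mul, abs_mul, abs_of_pos (inv_pos.2 hZs0)]
      have hk := bn s k y
      have hl := bn s l y
      have hZi : 0 ≤ Zs⁻¹ := (inv_pos.2 hZs0).le
      calc _ ≤ (cn * Zs ^ (1 - 1 / 2 : ℝ)) * Zs⁻¹ * ((cn * Zs ^ (1 - 1 / 2 : ℝ)) * Zs⁻¹) :=
            mul_le_mul (mul_le_mul_of_nonneg_right hk hZi) (mul_le_mul_of_nonneg_right hl hZi)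
              (by positivity) (by positivity)
        _ = cn ^ 2 * (Zs ^ (1 - 1 / 2 : ℝ) * Zs ^ (1 - 1 / 2 : ℝ)) * Zs⁻¹ * Zs⁻¹ := by ring
        _ = cn ^ 2 * Zs⁻¹ := by rw [hsq]; field_simp
    have hsum : |∑ k, ∑ l, Cf s k l *
        (((∫ ζ, fderiv ℝ (fun x => Ψ x * F x) (y + ζ) (EuclideanSpace.single k 1) ∂(P s)) * Zs⁻¹ -
            Ws * Zs⁻¹ * ((∫ ζ, fderiv ℝ Ψ (y + ζ) (EuclideanSpace.single k 1) ∂(P s)) * Zs⁻¹)) *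
          ((∫ ζ, fderiv ℝ (fun x => Ψ x * F x) (y + ζ) (EuclideanSpace.single l 1) ∂(P s)) * Zs⁻¹ -
            Ws * Zs⁻¹ * ((∫ ζ, fderiv ℝ Ψ (y + ζ) (EuclideanSpace.single l 1) ∂(P s)) * Zs⁻¹)))| ≤
        (∑ k : Fin N, ∑ l : Fin N, |KC| * cn ^ 2) * Zs⁻¹ := by
      rw [Finset.sum_mul]
      refine (Finset.abs_sum_le_sum_abs _ _).trans (Finset.sum_le_sum fun k _ => ?_)
      rw [Finset.sum_mul]
      refine (Finset.abs_sum_le_sum_abs _ _).trans (Finset.sum_le_sum fun l _ => ?_)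
      rw [abs_mul]
      calc |Cf s k l| * _ ≤ |KC| * (cn ^ 2 * Zs⁻¹) :=
            mul_le_mul (bC' s k l) (hgg k l) (abs_nonneg _) (abs_nonneg _)
        _ = |KC| * cn ^ 2 * Zs⁻¹ := by ring
    simp only [hK_def]
    rw [abs_mul, abs_of_pos hZs0, abs_mul, abs_of_pos (by norm_num : (0 : ℝ) < 1 / 4), abs_mul,
      abs_inv, abs_of_pos hus0]
    calc Zs * (1 / 4 * (|∑ k, ∑ l, Cf s k l * _| * (Ws * Zs⁻¹)⁻¹))
        ≤ Zs * (1 / 4 * (((∑ k : Fin N, ∑ l : Fin N, |KC| * cn ^ 2) * Zs⁻¹) * a⁻¹)) := by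
          refine mul_le_mul_of_nonneg_left (mul_le_mul_of_nonneg_left ?_ (by norm_num)) hZs0.le
          exact mul_le_mul hsum (inv_anti₀ ha hus) (inv_nonneg.2 hus0.le)
            (mul_nonneg (Finset.sum_nonneg fun _ _ => Finset.sum_nonneg fun _ _ => by positivity)
              (inv_nonneg.2 hZs0.le))
      _ = K0 := by rw [hK0]; field_simp
  ---------------------------------------------------------------- the slope `K̇ = Ż H + Z Ḣ`
  set Kd : EuclideanSpace ℝ (Fin N) → ℝ := fun y => Zd y * H y + (∫ ζ, Ψ (y + ζ) ∂(P t)) * Hd y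
    with hKd_def
  have pKd := jpack_add (jpack_mul_tpack hZ pZd pH) (jpack_mul_tpack hZ pZ pHd)
  have hKdc : Continuous Kd := continuous_iff_continuousAt.2 fun y => (pKd.1 y).continuousAt
  obtain ⟨Kd0, -, hKdb⟩ := bounded_of_jet pKd.2.2.1
  obtain ⟨Kd1, -, hKd1⟩ := bounded_of_jet pKd.2.2.2.1
  have hKduc : UniformContinuous Kd := uc_of_hasFDerivAt_bound pKd.1 hKd1
  ---------------------------------------------------------------- the tempered slope (proved below)
  -- (U0) `K_s − K_t − (s−t)K̇ = ¼ Σ_{kl} T_{kl}` with the per-pair quantity of `sqrtEnergy_pair_bound`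
  have eS : ∀ y, ∑ k, ∑ l, Cf t k l * (gd k y * g l y + g k y * gd l y) =
      2 * ∑ k, ∑ l, Cf t k l * (gd k y * g l y) := by
    intro y
    have h1 : ∑ k, ∑ l, Cf t k l * (g k y * gd l y) = ∑ k, ∑ l, Cf t k l * (gd k y * g l y) := by
      rw [Finset.sum_comm]
      refine Finset.sum_congr rfl fun k _ => Finset.sum_congr rfl fun l _ => ?_
      rw [hCs k l]; ring
    have h2 : ∑ k, ∑ l, Cf t k l * (gd k y * g l y + g k y * gd l y) =
        ∑ k, ∑ l, Cf t k l * (gd k y * g l y) + ∑ k, ∑ l, Cf t k l * (g k y * gd l y) := by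
      rw [← Finset.sum_add_distrib]
      refine Finset.sum_congr rfl fun k _ => ?_
      rw [← Finset.sum_add_distrib]
      refine Finset.sum_congr rfl fun l _ => ?_
      ring
    rw [h2, h1]; ring
  have hTsum : ∀ s y, K s y - K t y - (s - t) * Kd y = (1 / 4) * ∑ k, ∑ l,
      (Cf s k l * ((∫ ζ, Ψ (y + ζ) ∂(P s)) *
          (((∫ ζ, fderiv ℝ (fun x => Ψ x * F x) (y + ζ) (EuclideanSpace.single k 1) ∂(P s)) *
                (∫ ζ, Ψ (y + ζ) ∂(P s))⁻¹ -
              (∫ ζ, Ψ (y + ζ) * F (y + ζ) ∂(P s)) * (∫ ζ, Ψ (y + ζ) ∂(P s))⁻¹ *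
                ((∫ ζ, fderiv ℝ Ψ (y + ζ) (EuclideanSpace.single k 1) ∂(P s)) *
                  (∫ ζ, Ψ (y + ζ) ∂(P s))⁻¹)) *
            ((∫ ζ, fderiv ℝ (fun x => Ψ x * F x) (y + ζ) (EuclideanSpace.single l 1) ∂(P s)) *
                (∫ ζ, Ψ (y + ζ) ∂(P s))⁻¹ -
              (∫ ζ, Ψ (y + ζ) * F (y + ζ) ∂(P s)) * (∫ ζ, Ψ (y + ζ) ∂(P s))⁻¹ *
                ((∫ ζ, fderiv ℝ Ψ (y + ζ) (EuclideanSpace.single l 1) ∂(P s)) *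
                  (∫ ζ, Ψ (y + ζ) ∂(P s))⁻¹)) *
            ((∫ ζ, Ψ (y + ζ) * F (y + ζ) ∂(P s)) * (∫ ζ, Ψ (y + ζ) ∂(P s))⁻¹)⁻¹)) -
        Cf t k l * ((∫ ζ, Ψ (y + ζ) ∂(P t)) * (g k y * g l y * (u y)⁻¹)) -
        (s - t) * (D.Cddot t k l * ((∫ ζ, Ψ (y + ζ) ∂(P t)) * (g k y * g l y * (u y)⁻¹)) +
          Cf t k l * (Zd y * (g k y * g l y * (u y)⁻¹) +
            (∫ ζ, Ψ (y + ζ) ∂(P t)) * ((gd k y * g l y + g k y * gd l y) * (u y)⁻¹ -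
              g k y * g l y * ud y * ((u y)⁻¹ * (u y)⁻¹))))) := by
    intro s y
    -- both sides as explicit combinations of double sums
    have eR : ∑ k, ∑ l,
        (Cf s k l * ((∫ ζ, Ψ (y + ζ) ∂(P s)) *
            (((∫ ζ, fderiv ℝ (fun x => Ψ x * F x) (y + ζ) (EuclideanSpace.single k 1) ∂(P s)) *
                  (∫ ζ, Ψ (y + ζ) ∂(P s))⁻¹ -
                (∫ ζ, Ψ (y + ζ) * F (y + ζ) ∂(P s)) * (∫ ζ, Ψ (y + ζ) ∂(P s))⁻¹ *
                  ((∫ ζ, fderiv ℝ Ψ (y + ζ) (EuclideanSpace.single k 1) ∂(P s)) *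
                    (∫ ζ, Ψ (y + ζ) ∂(P s))⁻¹)) *
              ((∫ ζ, fderiv ℝ (fun x => Ψ x * F x) (y + ζ) (EuclideanSpace.single l 1) ∂(P s)) *
                  (∫ ζ, Ψ (y + ζ) ∂(P s))⁻¹ -
                (∫ ζ, Ψ (y + ζ) * F (y + ζ) ∂(P s)) * (∫ ζ, Ψ (y + ζ) ∂(P s))⁻¹ *
                  ((∫ ζ, fderiv ℝ Ψ (y + ζ) (EuclideanSpace.single l 1) ∂(P s)) *
                    (∫ ζ, Ψ (y + ζ) ∂(P s))⁻¹)) *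
              ((∫ ζ, Ψ (y + ζ) * F (y + ζ) ∂(P s)) * (∫ ζ, Ψ (y + ζ) ∂(P s))⁻¹)⁻¹)) -
          Cf t k l * ((∫ ζ, Ψ (y + ζ) ∂(P t)) * (g k y * g l y * (u y)⁻¹)) -
          (s - t) * (D.Cddot t k l * ((∫ ζ, Ψ (y + ζ) ∂(P t)) * (g k y * g l y * (u y)⁻¹)) +
            Cf t k l * (Zd y * (g k y * g l y * (u y)⁻¹) +
              (∫ ζ, Ψ (y + ζ) ∂(P t)) * ((gd k y * g l y + g k y * gd l y) * (u y)⁻¹ -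
                g k y * g l y * ud y * ((u y)⁻¹ * (u y)⁻¹))))) =
        (∫ ζ, Ψ (y + ζ) ∂(P s)) * ((∫ ζ, Ψ (y + ζ) * F (y + ζ) ∂(P s)) *
            (∫ ζ, Ψ (y + ζ) ∂(P s))⁻¹)⁻¹ * ∑ k, ∑ l, Cf s k l *
            (((∫ ζ, fderiv ℝ (fun x => Ψ x * F x) (y + ζ) (EuclideanSpace.single k 1) ∂(P s)) *
                  (∫ ζ, Ψ (y + ζ) ∂(P s))⁻¹ -
                (∫ ζ, Ψ (y + ζ) * F (y + ζ) ∂(P s)) * (∫ ζ, Ψ (y + ζ) ∂(P s))⁻¹ *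
                  ((∫ ζ, fderiv ℝ Ψ (y + ζ) (EuclideanSpace.single k 1) ∂(P s)) *
                    (∫ ζ, Ψ (y + ζ) ∂(P s))⁻¹)) *
              ((∫ ζ, fderiv ℝ (fun x => Ψ x * F x) (y + ζ) (EuclideanSpace.single l 1) ∂(P s)) *
                  (∫ ζ, Ψ (y + ζ) ∂(P s))⁻¹ -
                (∫ ζ, Ψ (y + ζ) * F (y + ζ) ∂(P s)) * (∫ ζ, Ψ (y + ζ) ∂(P s))⁻¹ *
                  ((∫ ζ, fderiv ℝ Ψ (y + ζ) (EuclideanSpace.single l 1) ∂(P s)) *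
                    (∫ ζ, Ψ (y + ζ) ∂(P s))⁻¹))) -
          (∫ ζ, Ψ (y + ζ) ∂(P t)) * (u y)⁻¹ * (∑ k, ∑ l, Cf t k l * (g k y * g l y)) -
          (s - t) * ((∫ ζ, Ψ (y + ζ) ∂(P t)) * (u y)⁻¹ * (∑ k, ∑ l, D.Cddot t k l * (g k y * g l y)) +
            Zd y * (u y)⁻¹ * (∑ k, ∑ l, Cf t k l * (g k y * g l y)) +
            (∫ ζ, Ψ (y + ζ) ∂(P t)) * (u y)⁻¹ *
              (∑ k, ∑ l, Cf t k l * (gd k y * g l y + g k y * gd l y)) -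
            (∫ ζ, Ψ (y + ζ) ∂(P t)) * ud y * ((u y)⁻¹ * (u y)⁻¹) *
              (∑ k, ∑ l, Cf t k l * (g k y * g l y))) := by
      simp only [Finset.mul_sum, ← Finset.sum_sub_distrib, ← Finset.sum_add_distrib]
      refine Finset.sum_congr rfl fun k _ => Finset.sum_congr rfl fun l _ => ?_
      ring
    rw [eR, eS]
    simp only [hK_def, hKd_def, hH_def, hA_def, hHd_def, hAd_def]
    ring
  -- (U1) slope data for hU: bounds of the slopes, uniform slopes of all atoms, Gaussian lower bound
  obtain ⟨KZd, hKZd0, hKZd⟩ := bounded_of_jet pZd.2.2.1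
  obtain ⟨KWd, hKWd0, hKWd⟩ := bounded_of_jet pWd.2.2.1
  have hZ1dB := fun k : Fin N => bounded_of_jet (pZ1d k).2.2.1
  have hW1dB := fun k : Fin N => bounded_of_jet (pW1d k).2.2.1
  choose KZ1d hKZ1d0 hKZ1d using hZ1dB
  choose KW1d hKW1d0 hKW1d using hW1dB
  obtain ⟨KD, hKD⟩ : ∃ x : ℝ, x = KZd + KWd + ∑ k, (KZ1d k + KW1d k) := ⟨_, rfl⟩
  have hKD0 : 0 ≤ KD := by
    rw [hKD]; exact add_nonneg (add_nonneg hKZd0 hKWd0)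
      (Finset.sum_nonneg fun k _ => add_nonneg (hKZ1d0 k) (hKW1d0 k))
  have hsumK : ∀ k : Fin N, KZ1d k + KW1d k ≤ ∑ j, (KZ1d j + KW1d j) := fun k =>
    Finset.single_le_sum (f := fun j => KZ1d j + KW1d j) (fun j _ => add_nonneg (hKZ1d0 j) (hKW1d0 j))
      (Finset.mem_univ k)
  have bZdK : ∀ y, |Zd y| ≤ KD := fun y => (hKZd y).trans (by
    rw [hKD]; nlinarith [hKWd0, Finset.sum_nonneg fun k (_ : k ∈ Finset.univ) =>
      add_nonneg (hKZ1d0 k) (hKW1d0 k)])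
  have bWdK : ∀ y, |Wd y| ≤ KD := fun y => (hKWd y).trans (by
    rw [hKD]; nlinarith [hKZd0, Finset.sum_nonneg fun k (_ : k ∈ Finset.univ) =>
      add_nonneg (hKZ1d0 k) (hKW1d0 k)])
  have bZ1dK : ∀ k y, |Z1d k y| ≤ KD := fun k y => (hKZ1d k y).trans (by
    rw [hKD]; nlinarith [hKZd0, hKWd0, hsumK k, hKW1d0 k])
  have bW1dK : ∀ k y, |W1d k y| ≤ KD := fun k y => (hKW1d k y).trans (by
    rw [hKD]; nlinarith [hKZd0, hKWd0, hsumK k, hKZ1d0 k])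
  -- uniform slopes of the atoms at `s = t` ([BBD] Prop 5)
  have sZ : ∀ ε : ℝ, 0 < ε → ∀ᶠ s in 𝓝 t, ∀ y : EuclideanSpace ℝ (Fin N),
      |(∫ ζ, Ψ (y + ζ) ∂(P s)) - (∫ ζ, Ψ (y + ζ) ∂(P t)) - (s - t) * Zd y| ≤ ε * |s - t| :=
    fun ε hε => sm_uniformSlope D hΨ4 hB4 ht ε hε
  have sW : ∀ ε : ℝ, 0 < ε → ∀ᶠ s in 𝓝 t, ∀ y : EuclideanSpace ℝ (Fin N),
      |(∫ ζ, Ψ (y + ζ) * F (y + ζ) ∂(P s)) - (∫ ζ, Ψ (y + ζ) * F (y + ζ) ∂(P t)) - (s - t) * Wd y| ≤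
        ε * |s - t| :=
    fun ε hε => sm_uniformSlope D hΨF4 hBΨF4 ht ε hε
  have sZ1 : ∀ ε : ℝ, 0 < ε → ∀ᶠ s in 𝓝 t, ∀ (k : Fin N) (y : EuclideanSpace ℝ (Fin N)),
      |(∫ ζ, fderiv ℝ Ψ (y + ζ) (EuclideanSpace.single k 1) ∂(P s)) -
        (∫ ζ, fderiv ℝ Ψ (y + ζ) (EuclideanSpace.single k 1) ∂(P t)) - (s - t) * Z1d k y| ≤
        ε * |s - t| := fun ε hε =>
    eventually_all.2 fun k => sm_partial_uniformSlope D hΨ4 hB4 (EuclideanSpace.single k 1) ht ε hε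
  have sW1 : ∀ ε : ℝ, 0 < ε → ∀ᶠ s in 𝓝 t, ∀ (k : Fin N) (y : EuclideanSpace ℝ (Fin N)),
      |(∫ ζ, fderiv ℝ (fun x => Ψ x * F x) (y + ζ) (EuclideanSpace.single k 1) ∂(P s)) -
        (∫ ζ, fderiv ℝ (fun x => Ψ x * F x) (y + ζ) (EuclideanSpace.single k 1) ∂(P t)) -
        (s - t) * W1d k y| ≤ ε * |s - t| := fun ε hε =>
    eventually_all.2 fun k => sm_partial_uniformSlope D hΨF4 hBΨF4 (EuclideanSpace.single k 1) ht ε hε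
  have sCf : ∀ ε : ℝ, 0 < ε → ∀ᶠ s in 𝓝 t, ∀ k l : Fin N,
      |Cf s k l - Cf t k l - (s - t) * D.Cddot t k l| ≤ ε * |s - t| := fun ε hε =>
    eventually_all.2 fun k => eventually_all.2 fun l => by
      filter_upwards [uniformSlope_of_hasDerivAt (α := EuclideanSpace ℝ (Fin N)) (sC k l) ε hε]
        with s hs using hs 0
  -- Gaussian lower bound for `Z_s`, uniform in `s` near `t`
  obtain ⟨mG, hmG, evG⟩ := eventually_mul_exp_neg_le_atom D hΨc hΨabs hc₁ hc₂ hlow ht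
  have evG' : ∀ᶠ s in 𝓝 t, ∀ y : EuclideanSpace ℝ (Fin N),
      mG * Real.exp (-(2 * c₂ * ‖y‖ ^ 2)) ≤ ∫ ζ, Ψ (y + ζ) ∂(P s) := evG
  -- (U2–U4) the tempered slope: `tempered_slope_sqrtEnergy` on the scalar data above
  have hU : ∀ a₀ : ℝ, 0 < a₀ → ∀ ε : ℝ, 0 < ε → ∀ᶠ s in 𝓝 t, ∀ y : EuclideanSpace ℝ (Fin N),
      |K s y - K t y - (s - t) * Kd y| ≤ ε * |s - t| * Real.exp (a₀ * ‖y‖ ^ 2) :=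
    tempered_slope_sqrtEnergy (K := K) (Kd := Kd) hZpos hZle ha (fun s y => (hWmem s y).1)
      (fun s y => (hWmem s y).2) bZ1δ bW1δ bC bZdK bWdK bZ1dK bW1dK sZ sW sZ1 sW1 sCf hmG hc₂
      evG' (fun s y => by rw [hTsum s y])
  ---------------------------------------------------------------- the tempered family rule at `φ = 0`
  have h1K : ∀ y, HasFDerivAt (K t)
      ((∫ ζ, Ψ (y + ζ) ∂(P t)) • DH y + H y • ∫ ζ, fderiv ℝ Ψ (y + ζ) ∂(P t)) y := by
    rw [hKt]; exact pK.1
  have hder := hasDerivAt_integral_family_Cinf_sub_of_sqExp D K Kd ht h1K pK.2.1 hKc hKb hMK hUCK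
    hKdc hKdb hKduc hU 0
  simp only [zero_add] at hder
  have hB' := hder.const_mul (Real.exp (renormPotentialInf D V₀ 0))
  ---------------------------------------------------------------- `∂_k P_{0,s}F` in the atoms, all `s`
  have hsemi_fun : ∀ s, semigroup D V₀ 0 s F =
      fun y => (∫ ζ, Ψ (y + ζ) * F (y + ζ) ∂(P s)) * (∫ ζ, Ψ (y + ζ) ∂(P s))⁻¹ :=
    fun s => funext (hsemi s)
  have hgf : ∀ s (k : Fin N) y, fderiv ℝ (semigroup D V₀ 0 s F) y (EuclideanSpace.single k 1) =
      (∫ ζ, fderiv ℝ (fun x => Ψ x * F x) (y + ζ) (EuclideanSpace.single k 1) ∂(P s)) *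
          (∫ ζ, Ψ (y + ζ) ∂(P s))⁻¹ -
        (∫ ζ, Ψ (y + ζ) * F (y + ζ) ∂(P s)) * (∫ ζ, Ψ (y + ζ) ∂(P s))⁻¹ *
          ((∫ ζ, fderiv ℝ Ψ (y + ζ) (EuclideanSpace.single k 1) ∂(P s)) * (∫ ζ, Ψ (y + ζ) ∂(P s))⁻¹) := by
    intro s k y
    obtain ⟨Du', D2u', pu', hDu', -⟩ := quotient_tjets (hZpos s) (pZs s) (pWs s) _ (fun _ => rfl)
    rw [hsemi_fun s, (pu'.1 y).fderiv, hDu', hZ1 s, hW1 s]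
    ring
  ---------------------------------------------------------------- the left-hand side
  have hLHS : (fun s => renormExpect D V₀ s fun y =>
      (1 / 4) * ((∑ k, ∑ l, D.Cdot (max s 0) k l *
        (fderiv ℝ (semigroup D V₀ 0 s F) y (EuclideanSpace.single k 1) *
          fderiv ℝ (semigroup D V₀ 0 s F) y (EuclideanSpace.single l 1))) *
        (semigroup D V₀ 0 s F y)⁻¹)) =
      fun s => Real.exp (renormPotentialInf D V₀ 0) *
        ∫ x, K s x ∂(multivariateGaussian 0 (D.Cinf - D.C s)) := by
    funext s
    unfold renormExpect
    congr 1
    refine integral_congr_ae (Eventually.of_forall fun x => ?_)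
    simp only [hK_def, hgf, hsemi, hCf_def]
    rw [exp_neg_renormPotential D hVm hb]
    simp only [hΨV, hP_def]
  refine ⟨Real.exp (renormPotentialInf D V₀ 0) * (-((1 / 2) * ∑ i, ∑ j, D.Cdot t i j *
      ∫ x, ((∫ ζ, Ψ (x + ζ) ∂(P t)) • D2H x +
          (∫ ζ, fderiv ℝ Ψ (x + ζ) ∂(P t)).smulRight (DH x) +
          (H x • (∫ ζ, fderiv ℝ (fderiv ℝ Ψ) (x + ζ) ∂(P t)) +
            (DH x).smulRight (∫ ζ, fderiv ℝ Ψ (x + ζ) ∂(P t))))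
        (EuclideanSpace.single i 1) (EuclideanSpace.single j 1)
        ∂(multivariateGaussian 0 (D.Cinf - D.C t))) +
      ∫ x, Kd x ∂(multivariateGaussian 0 (D.Cinf - D.C t))), ?_, ?_⟩
  · rw [hLHS]; exact hB'
  ---------------------------------------------------------------- the inequality of the values
  have hGt : (fun y => (1 / 4) * ((∑ k, ∑ l, D.Cdot (max t 0) k l *
      (fderiv ℝ (semigroup D V₀ 0 t F) y (EuclideanSpace.single k 1) *
        fderiv ℝ (semigroup D V₀ 0 t F) y (EuclideanSpace.single l 1))) *
      (semigroup D V₀ 0 t F y)⁻¹)) = H := by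
    funext y
    simp only [hH_def, hA_def, hg_def, hu_def, hCf_def, hgf, hsemi]
  rw [hGt]
  unfold renormExpect
  set Q : Measure (EuclideanSpace ℝ (Fin N)) := multivariateGaussian 0 (D.Cinf - D.C t) with hQ_def
  set D2K : EuclideanSpace ℝ (Fin N) → EuclideanSpace ℝ (Fin N) →L[ℝ] EuclideanSpace ℝ (Fin N) →L[ℝ] ℝ :=
    fun x => (∫ ζ, Ψ (x + ζ) ∂(P t)) • D2H x +
      (∫ ζ, fderiv ℝ Ψ (x + ζ) ∂(P t)).smulRight (DH x) +
      (H x • (∫ ζ, fderiv ℝ (fderiv ℝ Ψ) (x + ζ) ∂(P t)) +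
        (DH x).smulRight (∫ ζ, fderiv ℝ Ψ (x + ζ) ∂(P t))) with hD2K_def
  have hR : ∫ x, Real.exp (-renormPotential D V₀ t x) * H x ∂Q =
      ∫ x, (∫ ζ, Ψ (x + ζ) ∂(P t)) * H x ∂Q := by
    refine integral_congr_ae (Eventually.of_forall fun x => ?_)
    show Real.exp (-renormPotential D V₀ t x) * H x = (∫ ζ, Ψ (x + ζ) ∂(P t)) * H x
    rw [exp_neg_renormPotential D hVm hb]
    simp only [hΨV, hP_def]
  rw [hR]
  -- integrability
  have hD2Kc : Continuous D2K := hUCK.continuous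
  have cD2Kij : ∀ i j : Fin N, Continuous fun x =>
      D2K x (EuclideanSpace.single i 1) (EuclideanSpace.single j 1) := fun i j =>
    ((ContinuousLinearMap.apply ℝ ℝ (EuclideanSpace.single j 1)).comp
      (ContinuousLinearMap.apply ℝ (EuclideanSpace ℝ (Fin N) →L[ℝ] ℝ)
        (EuclideanSpace.single i 1))).continuous.comp hD2Kc
  have bD2Kij : ∀ (i j : Fin N) x,
      ‖D2K x (EuclideanSpace.single i 1) (EuclideanSpace.single j 1)‖ ≤ MK := fun i j x => by
    refine (ContinuousLinearMap.le_opNorm _ _).trans ?_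
    rw [Cb4.norm_single_one, mul_one]
    refine (ContinuousLinearMap.le_opNorm _ _).trans ?_
    rw [Cb4.norm_single_one, mul_one]
    exact hMK x
  have iD2Kij : ∀ i j : Fin N, Integrable (fun x =>
      D.Cdot t i j * D2K x (EuclideanSpace.single i 1) (EuclideanSpace.single j 1)) Q :=
    fun i j => (Integrable.of_bound (cD2Kij i j).aestronglyMeasurable MK
      (Eventually.of_forall fun x => bD2Kij i j x)).const_mul _
  have iKd : Integrable Kd Q :=
    Integrable.of_bound hKdc.aestronglyMeasurable Kd0
      (Eventually.of_forall fun x => by rw [Real.norm_eq_abs]; exact hKdb x)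
  have iZH : Integrable (fun x => (∫ ζ, Ψ (x + ζ) ∂(P t)) * H x) Q := by
    have hc : Continuous (fun x => (∫ ζ, Ψ (x + ζ) ∂(P t)) * H x) := by rw [← hKt]; exact hKc t
    refine Integrable.of_bound hc.aestronglyMeasurable K0 (Eventually.of_forall fun x => ?_)
    rw [Real.norm_eq_abs]
    have h := hKb t x
    rwa [hKt] at h
  have hsumint : (∑ i, ∑ j, D.Cdot t i j *
      ∫ x, D2K x (EuclideanSpace.single i 1) (EuclideanSpace.single j 1) ∂Q) =
      ∫ x, ∑ i, ∑ j, D.Cdot t i j * D2K x (EuclideanSpace.single i 1) (EuclideanSpace.single j 1) ∂Q := by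
    rw [integral_finsetSum _ fun i _ => integrable_finsetSum _ fun j _ => iD2Kij i j]
    refine Finset.sum_congr rfl fun i _ => ?_
    rw [integral_finsetSum _ fun j _ => iD2Kij i j]
    refine Finset.sum_congr rfl fun j _ => ?_
    rw [integral_const_mul]
  have iS : Integrable (fun x => ∑ i, ∑ j, D.Cdot t i j *
      D2K x (EuclideanSpace.single i 1) (EuclideanSpace.single j 1)) Q :=
    integrable_finsetSum _ fun i _ => integrable_finsetSum _ fun j _ => iD2Kij i j
  ---------------------------------------------------------------- the pointwise inequality
  have hCs' : ∀ i j, D.Cdot t j i = D.Cdot t i j := fun i j => D.Cdot_symm ht.le i j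
  have ptwise : ∀ x, Kd x - (1 / 2) * ∑ i, ∑ j, D.Cdot t i j *
      D2K x (EuclideanSpace.single i 1) (EuclideanSpace.single j 1) ≤
      -2 * lamdot t * ((∫ ζ, Ψ (x + ζ) ∂(P t)) * H x) := by
    intro x
    have hZx : 0 < ∫ ζ, Ψ (x + ζ) ∂(P t) := hZ x
    have hin := hineq x
    rw [hCft] at hin
    -- the identity `K̇ − ½Σ Ċ D²K = −Z·[(L_t H) − Ḣ]`
    have hid : Kd x - (1 / 2) * ∑ i, ∑ j, D.Cdot t i j *
        D2K x (EuclideanSpace.single i 1) (EuclideanSpace.single j 1) =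
        -((∫ ζ, Ψ (x + ζ) ∂(P t)) *
          (((1 / 2) * (∑ i, ∑ j, D.Cdot t i j *
              D2H x (EuclideanSpace.single i 1) (EuclideanSpace.single j 1)) -
            ∑ i, ∑ j, D.Cdot t i j *
              ((-(∫ ζ, fderiv ℝ Ψ (x + ζ) (EuclideanSpace.single i 1) ∂(P t)) /
                ∫ ζ, Ψ (x + ζ) ∂(P t)) * DH x (EuclideanSpace.single j 1))) - Hd x)) := by
      simp only [hKd_def, hD2K_def, _root_.add_apply, _root_.smul_apply,
        ContinuousLinearMap.smulRight_apply, smul_eq_mul, hZ1, sm_fderiv₂_apply hΨ4 hB4]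
      have e1 : ∑ i, ∑ j, D.Cdot t i j *
          ((∫ ζ, Ψ (x + ζ) ∂(P t)) * D2H x (EuclideanSpace.single i 1) (EuclideanSpace.single j 1) +
            (∫ ζ, fderiv ℝ Ψ (x + ζ) (EuclideanSpace.single i 1) ∂(P t)) *
              DH x (EuclideanSpace.single j 1) +
            (H x * ∫ ζ, fderiv ℝ (fderiv ℝ Ψ) (x + ζ) (EuclideanSpace.single i 1)
                (EuclideanSpace.single j 1) ∂(P t) +
              DH x (EuclideanSpace.single i 1) *
                ∫ ζ, fderiv ℝ Ψ (x + ζ) (EuclideanSpace.single j 1) ∂(P t))) =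
          (∫ ζ, Ψ (x + ζ) ∂(P t)) * ∑ i, ∑ j, D.Cdot t i j *
              D2H x (EuclideanSpace.single i 1) (EuclideanSpace.single j 1) +
            ∑ i, ∑ j, D.Cdot t i j * ((∫ ζ, fderiv ℝ Ψ (x + ζ) (EuclideanSpace.single i 1) ∂(P t)) *
              DH x (EuclideanSpace.single j 1)) +
            H x * ∑ i, ∑ j, D.Cdot t i j * ∫ ζ, fderiv ℝ (fderiv ℝ Ψ) (x + ζ)
              (EuclideanSpace.single i 1) (EuclideanSpace.single j 1) ∂(P t) +
            ∑ i, ∑ j, D.Cdot t i j * (DH x (EuclideanSpace.single i 1) *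
              ∫ ζ, fderiv ℝ Ψ (x + ζ) (EuclideanSpace.single j 1) ∂(P t)) := by
        simp only [Finset.mul_sum, ← Finset.sum_add_distrib]
        refine Finset.sum_congr rfl fun i _ => Finset.sum_congr rfl fun j _ => ?_
        ring
      have eSym : ∑ i, ∑ j, D.Cdot t i j * (DH x (EuclideanSpace.single i 1) *
          ∫ ζ, fderiv ℝ Ψ (x + ζ) (EuclideanSpace.single j 1) ∂(P t)) =
          ∑ i, ∑ j, D.Cdot t i j * ((∫ ζ, fderiv ℝ Ψ (x + ζ) (EuclideanSpace.single i 1) ∂(P t)) *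
            DH x (EuclideanSpace.single j 1)) := by
        rw [Finset.sum_comm]
        refine Finset.sum_congr rfl fun i _ => Finset.sum_congr rfl fun j _ => ?_
        rw [hCs' i j]
        ring
      have eP : (∫ ζ, Ψ (x + ζ) ∂(P t)) * ∑ i, ∑ j, D.Cdot t i j *
          ((-(∫ ζ, fderiv ℝ Ψ (x + ζ) (EuclideanSpace.single i 1) ∂(P t)) / ∫ ζ, Ψ (x + ζ) ∂(P t)) *
            DH x (EuclideanSpace.single j 1)) =
          -∑ i, ∑ j, D.Cdot t i j * ((∫ ζ, fderiv ℝ Ψ (x + ζ) (EuclideanSpace.single i 1) ∂(P t)) *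
            DH x (EuclideanSpace.single j 1)) := by
        rw [Finset.mul_sum, ← Finset.sum_neg_distrib]
        refine Finset.sum_congr rfl fun i _ => ?_
        rw [Finset.mul_sum, ← Finset.sum_neg_distrib]
        refine Finset.sum_congr rfl fun j _ => ?_
        have hZne : (∫ ζ, Ψ (x + ζ) ∂(P t)) ≠ 0 := hZx.ne'
        field_simp
      rw [e1, eSym]
      simp only [hZd_def]
      linear_combination (-1 : ℝ) * eP
    rw [hid]
    have hZHd : 2 * lamdot t * H x ≤
        ((1 / 2) * (∑ i, ∑ j, D.Cdot t i j *
            D2H x (EuclideanSpace.single i 1) (EuclideanSpace.single j 1)) -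
          ∑ i, ∑ j, D.Cdot t i j *
            ((-(∫ ζ, fderiv ℝ Ψ (x + ζ) (EuclideanSpace.single i 1) ∂(P t)) /
              ∫ ζ, Ψ (x + ζ) ∂(P t)) * DH x (EuclideanSpace.single j 1))) - Hd x := hin
    nlinarith [hZHd, hZx]
  ---------------------------------------------------------------- integrate
  have key : -((1 / 2) * ∑ i, ∑ j, D.Cdot t i j *
      ∫ x, D2K x (EuclideanSpace.single i 1) (EuclideanSpace.single j 1) ∂Q) + ∫ x, Kd x ∂Q ≤
      -2 * lamdot t * ∫ x, (∫ ζ, Ψ (x + ζ) ∂(P t)) * H x ∂Q := by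
    have e1 : -((1 / 2) * ∑ i, ∑ j, D.Cdot t i j *
        ∫ x, D2K x (EuclideanSpace.single i 1) (EuclideanSpace.single j 1) ∂Q) + ∫ x, Kd x ∂Q =
        ∫ x, (Kd x - (1 / 2) * ∑ i, ∑ j, D.Cdot t i j *
          D2K x (EuclideanSpace.single i 1) (EuclideanSpace.single j 1)) ∂Q := by
      rw [hsumint, integral_sub iKd (iS.const_mul _), integral_const_mul]
      ring
    have e2 : -2 * lamdot t * ∫ x, (∫ ζ, Ψ (x + ζ) ∂(P t)) * H x ∂Q =
        ∫ x, -2 * lamdot t * ((∫ ζ, Ψ (x + ζ) ∂(P t)) * H x) ∂Q := (integral_const_mul _ _).symm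
    rw [e1, e2]
    exact integral_mono (iKd.sub (iS.const_mul _)) (iZH.const_mul _) ptwise
  show Real.exp (renormPotentialInf D V₀ 0) * (-((1 / 2) * ∑ i, ∑ j, D.Cdot t i j *
      ∫ x, D2K x (EuclideanSpace.single i 1) (EuclideanSpace.single j 1) ∂Q) + ∫ x, Kd x ∂Q) ≤
    -2 * lamdot t * (Real.exp (renormPotentialInf D V₀ 0) * ∫ x, (∫ ζ, Ψ (x + ζ) ∂(P t)) * H x ∂Q)
  have hexp0 : 0 ≤ Real.exp (renormPotentialInf D V₀ 0) := (Real.exp_pos _).le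
  calc _ ≤ Real.exp (renormPotentialInf D V₀ 0) *
        (-2 * lamdot t * ∫ x, (∫ ζ, Ψ (x + ζ) ∂(P t)) * H x ∂Q) :=
        mul_le_mul_of_nonneg_left key hexp0
    _ = _ := by ring

end Exchange

end Polchinski

end Literature.Analysis.FunctionSpaces

end
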